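import Summits.QuantumFields.GaugeBoot.ClassBStrongCoupling
import HarnessLib

/-!
# Diagonal-RP infinite-volume DLR states exist at every coupling (gauge-boot, L3(β))

HONEST FRAMING (cell `pub-gaugeboot`, page 1 of every file): the venture produces certified bounds
on lattice expectations at stated coupling, gauge group, dimension and torus size; NOT a mass gap,
NOT a continuum limit, NOT a string tension; NOT Yang–Mills-summit-bearing (barriers
`FixedCouplingUltralocality`, `PerturbativeInvisibility`).

Unconditional companion of `ClassBStrongCoupling.lean` (no uniqueness hypothesis, every `β ≥ 0`,
every compact second countable `G`, continuous `ρ`): the unit-boundary-condition Wilson kernels of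
the symmetric cubes `[-n, n]^d` — each reflection positive in every diagonal hyperplane `x_i = x_j`
(`DiagRP.isReflectionPositiveFor_diag_ymSpecification_box`) and swap invariant
(`DiagRP.integral_comp_configDiagSwapZd_ymSpecification`) — have weakly convergent subsequences by
compactness, and every such limit is

* a DLR state (`mem_ymGibbsMeasures_of_tendsto_ymSpecification`, Georgii Thm. 4.17),
* invariant under every diagonal swap (`map_configDiagSwapZd_eq_of_tendsto_boxKernels`), and
* reflection positive in every diagonal hyperplane for ALL bounded measurable half-space observables
  (`diagRP_of_tendsto_boxKernels`, via the closure lemma `IsReflectionPositiveFor.of_continuous_cylinder`).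

Hence `exists_mem_ymGibbsMeasures_diagRP`: **at every `β ≥ 0` there is an infinite-volume DLR state
of lattice Yang–Mills theory that is reflection positive in all diagonal hyperplanes.** What is NOT
shown (and is open in general): that such a state is translation invariant, or that it coincides with
a torus limit point — so this is NOT the Class-B identification (`ThermodynamicLimitIsClassB`), which
`ClassBStrongCoupling.lean` settles only under DLR uniqueness.

References: H.-O. Georgii, Gibbs Measures and Phase Transitions (2011), Thm. 4.17;
K. Osterwalder, E. Seiler, Ann. Phys. 110 (1978) 440; V. Kazakov, Z. Zheng, arXiv:2203.11360 §3.1.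
-/

noncomputable section

open MeasureTheory Filter Topology
open scoped ComplexOrder ComplexConjugate
open Literature.Probability.LatticeModels (box)
open Literature.MathematicalPhysics.QuantumLattice
open Literature.MathematicalPhysics.QuantumFieldTheory (measure_eq_of_integral_cylinder_eq)

namespace Summit.QuantumFields.GaugeBoot

variable {d N : ℕ} {G : Type*} [Group G] [TopologicalSpace G] [IsTopologicalGroup G]
  [CompactSpace G] [MeasurableSpace G] [BorelSpace G] [T2Space G] [SecondCountableTopology G]
variable (ρ : G →* Matrix (Fin N) (Fin N) ℂ)

section BoxLimits

omit [Group G] [IsTopologicalGroup G] [CompactSpace G] [T2Space G] in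
/-- Integrals of a bounded continuous function converge along a weakly convergent sequence of
probability measures on configurations. -/
theorem tendsto_integral_of_tendsto_probabilityMeasure {P : ℕ → ProbabilityMeasure (LGConfig d G)}
    {ν : ProbabilityMeasure (LGConfig d G)} (hlim : Tendsto P atTop (𝓝 ν)) {F : LGConfig d G → ℝ}
    (hFc : Continuous F) {C : ℝ} (hC : ∀ U, |F U| ≤ C) :
    Tendsto (fun k => ∫ U, F U ∂(P k : Measure (LGConfig d G))) atTop
      (𝓝 (∫ U, F U ∂(ν : Measure (LGConfig d G)))) := by
  let Fb : BoundedContinuousFunction (LGConfig d G) ℝ :=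
    BoundedContinuousFunction.ofNormedAddCommGroup F hFc C
      (fun U => by simpa [Real.norm_eq_abs] using hC U)
  exact (ProbabilityMeasure.tendsto_iff_forall_integral_tendsto.1 hlim) Fb

/-- **Weak limits of the symmetric-cube kernels are swap invariant**: if the unit-boundary-condition
kernels of the cubes `[-φ(k), φ(k)]^d` converge weakly to `ν`, then `ν ∘ Θ_{ij}⁻¹ = ν` for every
diagonal swap `Θ_{ij} = configDiagSwapZd i j`. -/
theorem map_configDiagSwapZd_eq_of_tendsto_boxKernels (hρ : Continuous ρ) (β : ℝ) (φ : ℕ → ℕ)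
    {P : ℕ → ProbabilityMeasure (LGConfig d G)}
    (hP : ∀ k, (P k : Measure (LGConfig d G)) =
      ymSpecification ρ β (box d (φ k) ×ˢ (Finset.univ : Finset (Fin d))) 1)
    {ν : ProbabilityMeasure (LGConfig d G)} (hlim : Tendsto P atTop (𝓝 ν)) (i j : Fin d) :
    (ν : Measure (LGConfig d G)).map (configDiagSwapZd i j) = ν := by
  have hΘm : Measurable (configDiagSwapZd (G := G) i j) := DiagRP.measurable_configDiagSwapZd
  haveI : IsProbabilityMeasure ((ν : Measure (LGConfig d G)).map (configDiagSwapZd (G := G) i j)) :=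
    Measure.isProbabilityMeasure_map hΘm.aemeasurable
  refine measure_eq_of_integral_cylinder_eq fun F S _ hFc hFb => ?_
  obtain ⟨C, hC⟩ := hFb
  rw [integral_map hΘm.aemeasurable hFc.aestronglyMeasurable]
  have h1 := tendsto_integral_of_tendsto_probabilityMeasure hlim
    (hFc.comp (continuous_configDiagSwapZd i j)) (C := C) (fun U => hC _)
  have h2 := tendsto_integral_of_tendsto_probabilityMeasure hlim hFc hC
  have heq : ∀ k, ∫ U, (F ∘ configDiagSwapZd i j) U ∂(P k : Measure (LGConfig d G)) =
      ∫ U, F U ∂(P k : Measure (LGConfig d G)) := fun k => by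
    rw [hP k]
    exact DiagRP.integral_comp_configDiagSwapZd_ymSpecification ρ hρ β
      (fun e he => DiagRP.edgeSwap_mem_box_product (φ k) e he) DiagRP.configDiagSwapZd_one
      hFc.measurable
  simp only [heq] at h1
  exact tendsto_nhds_unique h1 h2

/-- **Weak limits of the symmetric-cube kernels are diagonal-RP** (`β ≥ 0`, `i ≠ j`): reflection
positivity in the hyperplane `x_i = x_j` of each cube kernel
(`DiagRP.isReflectionPositiveFor_diag_ymSpecification_box`) passes to the weak limit on continuous
cylinder observables, and then to all bounded measurable observables of the half `{x_i ≥ x_j}`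
(`IsReflectionPositiveFor.of_continuous_cylinder`, using swap invariance of the limit). -/
theorem diagRP_of_tendsto_boxKernels (hρ : Continuous ρ) {β : ℝ} (hβ : 0 ≤ β) (φ : ℕ → ℕ)
    {P : ℕ → ProbabilityMeasure (LGConfig d G)}
    (hP : ∀ k, (P k : Measure (LGConfig d G)) =
      ymSpecification ρ β (box d (φ k) ×ˢ (Finset.univ : Finset (Fin d))) 1)
    {ν : ProbabilityMeasure (LGConfig d G)} (hlim : Tendsto P atTop (𝓝 ν)) {i j : Fin d}
    (hij : i ≠ j) :
    IsReflectionPositiveFor (configDiagSwapZd (G := G) i j) (diagHalfEdges i j)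
      (ν : Measure (LGConfig d G)) := by
  have hΘ : MeasurePreserving (configDiagSwapZd (G := G) i j) (ν : Measure (LGConfig d G)) ν :=
    ⟨DiagRP.measurable_configDiagSwapZd,
      map_configDiagSwapZd_eq_of_tendsto_boxKernels ρ hρ β φ hP hlim i j⟩
  refine IsReflectionPositiveFor.of_continuous_cylinder hΘ fun F T _ hFc hFb hFS => ?_
  obtain ⟨C, hC⟩ := hFb
  set H : LGConfig d G → ℂ := fun U => conj (F (configDiagSwapZd i j U)) * F U with hH
  have hHc : Continuous H :=
    (Complex.continuous_conj.comp (hFc.comp (continuous_configDiagSwapZd i j))).mul hFc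
  have hHb : ∀ U, ‖H U‖ ≤ C * C := fun U => by
    simp only [hH, norm_mul, Complex.norm_conj]
    exact mul_le_mul (hC _) (hC _) (norm_nonneg _) ((norm_nonneg (F U)).trans (hC U))
  have hre : Tendsto (fun k => ∫ U, (H U).re ∂(P k : Measure (LGConfig d G))) atTop
      (𝓝 (∫ U, (H U).re ∂(ν : Measure (LGConfig d G)))) :=
    tendsto_integral_of_tendsto_probabilityMeasure hlim (Complex.continuous_re.comp hHc)
      (C := C * C) fun U => (Complex.abs_re_le_norm _).trans (hHb U)
  have him : Tendsto (fun k => ∫ U, (H U).im ∂(P k : Measure (LGConfig d G))) atTop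
      (𝓝 (∫ U, (H U).im ∂(ν : Measure (LGConfig d G)))) :=
    tendsto_integral_of_tendsto_probabilityMeasure hlim (Complex.continuous_im.comp hHc)
      (C := C * C) fun U => (Complex.abs_im_le_norm _).trans (hHb U)
  -- each cube pairing is non-negative
  have hev : ∀ k, 0 ≤ ∫ U, (H U).re ∂(P k : Measure (LGConfig d G)) ∧
      ∫ U, (H U).im ∂(P k : Measure (LGConfig d G)) = 0 := by
    intro k
    have hpos : 0 ≤ ∫ U, H U ∂(P k : Measure (LGConfig d G)) := by
      rw [hP k]
      exact DiagRP.isReflectionPositiveFor_diag_ymSpecification_box ρ hρ hij hβ (φ k) F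
        hFc.measurable ⟨C, hC⟩ hFS
    have hint : Integrable H (P k : Measure (LGConfig d G)) :=
      Integrable.of_bound hHc.measurable.aestronglyMeasurable (C * C) (ae_of_all _ fun U => hHb _)
    obtain ⟨h1, h2⟩ := Complex.nonneg_iff.1 hpos
    have hre_eq : (∫ U, H U ∂(P k : Measure (LGConfig d G))).re =
        ∫ U, (H U).re ∂(P k : Measure (LGConfig d G)) := by
      have h := integral_re hint
      simp only [RCLike.re_to_complex] at h
      exact h.symm
    have him_eq : (∫ U, H U ∂(P k : Measure (LGConfig d G))).im =
        ∫ U, (H U).im ∂(P k : Measure (LGConfig d G)) := by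
      have h := integral_im hint
      simp only [RCLike.im_to_complex] at h
      exact h.symm
    exact ⟨hre_eq ▸ h1, (him_eq ▸ h2).symm⟩
  -- pass to the limit
  have hint : Integrable H (ν : Measure (LGConfig d G)) :=
    Integrable.of_bound hHc.measurable.aestronglyMeasurable (C * C) (ae_of_all _ fun U => hHb _)
  have h1 : 0 ≤ ∫ U, (H U).re ∂(ν : Measure (LGConfig d G)) :=
    ge_of_tendsto hre (Filter.Eventually.of_forall fun k => (hev k).1)
  have h2 : ∫ U, (H U).im ∂(ν : Measure (LGConfig d G)) = 0 := by
    refine tendsto_nhds_unique him ?_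
    exact tendsto_const_nhds.congr' (Filter.Eventually.of_forall fun k => (hev k).2.symm)
  have hre' : (∫ U, H U ∂(ν : Measure (LGConfig d G))).re =
      ∫ U, (H U).re ∂(ν : Measure (LGConfig d G)) := by
    have h := integral_re hint
    simp only [RCLike.re_to_complex] at h
    exact h.symm
  have him' : (∫ U, H U ∂(ν : Measure (LGConfig d G))).im =
      ∫ U, (H U).im ∂(ν : Measure (LGConfig d G)) := by
    have h := integral_im hint
    simp only [RCLike.im_to_complex] at h
    exact h.symm
  refine Complex.nonneg_iff.2 ⟨?_, ?_⟩
  · rw [hre']; exact h1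
  · rw [him', h2]

/-- **AT EVERY `β ≥ 0` THERE IS A DIAGONAL-RP INFINITE-VOLUME DLR STATE** (compact second countable
`G`, continuous `ρ`): some subsequential weak limit of the unit-boundary-condition Wilson states of the
symmetric cubes `[-n, n]^d` exists (compactness), is a DLR state at `β`, is invariant under every
diagonal swap, and is reflection positive in every diagonal hyperplane `x_i = x_j`, `i ≠ j`.
(Translation invariance of such a state, and its relation to the torus limit points, are NOT claimed.) -/
theorem exists_mem_ymGibbsMeasures_diagRP (hρ : Continuous ρ) {β : ℝ} (hβ : 0 ≤ β) :
    ∃ ν ∈ ymGibbsMeasures (d := d) ρ β, ∀ i j : Fin d,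
      ν.map (configDiagSwapZd i j) = ν ∧
        (i ≠ j → IsReflectionPositiveFor (configDiagSwapZd (G := G) i j) (diagHalfEdges i j) ν) := by
  let P : ℕ → ProbabilityMeasure (LGConfig d G) := fun n =>
    ⟨ymSpecification ρ β (box d n ×ˢ (Finset.univ : Finset (Fin d))) 1,
      isProbabilityMeasure_ymSpecification ρ hρ β _ 1⟩
  obtain ⟨ν, -, φ, hφ, hlim⟩ :=
    (isCompact_univ (X := ProbabilityMeasure (LGConfig d G))).tendsto_subseq
      fun n => Set.mem_univ (P n)
  have hP : ∀ k, ((P ∘ φ) k : Measure (LGConfig d G)) =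
      ymSpecification ρ β (box d (φ k) ×ˢ (Finset.univ : Finset (Fin d))) 1 := fun _ => rfl
  have hΛ : ∀ Λ₀ : Finset (ZdEdge d), ∀ᶠ k in atTop,
      Λ₀ ⊆ box d (φ k) ×ˢ (Finset.univ : Finset (Fin d)) := fun Λ₀ =>
    hφ.tendsto_atTop.eventually (eventually_subset_box_product Λ₀)
  refine ⟨ν, mem_ymGibbsMeasures_of_tendsto_ymSpecification ρ hρ β hΛ (fun _ => 1) hP hlim,
    fun i j => ⟨map_configDiagSwapZd_eq_of_tendsto_boxKernels ρ hρ β φ hP hlim i j, fun hij => ?_⟩⟩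
  exact diagRP_of_tendsto_boxKernels ρ hρ hβ φ hP hlim hij

end BoxLimits

end Summit.QuantumFields.GaugeBoot
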